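import Summits.NavierStokesRegularity.NavierStokesRegularity.Theses.AxisymmetricExtremality
import Literature.Analysis.FluidPDE.Seregin2020SwirlMoserCutoffs
import Literature.Analysis.FluidPDE.CylindricalIntegration
import Literature.Analysis.Calculus.SmoothCutoff
import Literature.Barriers.NavierStokesRegularity.AxisymmetricTypeIExclusionProofs
import HarnessLib

/-!
# Seregin 2020, Lemma 2.2 (after Nazarov–Uraltseva 2012): the axis term
# `∫ F (2x'/|x'|²)·∇ψ_ε dx → 4π ∫ F(0, 0, x₃) dx₃` of the very weak form

Helper toward the stub `stub_seregin2020TypeII` of the crux `AxisymmetricKatoGlobal` (= the named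
fact `Literature.Analysis.FluidPDE.Seregin2020_axisymmetricSingularPoint_typeII`, G. Seregin,
Anal. Math. Phys. 10 (2020) Paper 46 = arXiv:2006.04140, Thm 2.1; remaining ingredient Lemma 2.2
in the corrected rendering `hWH′`). The printed proof of Lemma 2.2 (arXiv p. 8) rests on the
inequality `∫ (∂ₜπ η + ∇π·∇η - (u + 2x'/|x'|²)·∇η π) ≥ 4π₀ ∫ πη dx₃dt`, whose right-hand side is
the distributional divergence `div (2x'/|x'|²) = 4π₀ δ_{axis}` (Nazarov–Uraltseva 2012, (4.3))
tested against `πη`. With the axis cut off smoothly by `ψ_ε(x) = sT((2/ε)|x'| - 1)`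
(`sT = Real.smoothTransition`; the tree's `Seregin2020.axisCutoff_props`), the axis term appears
as the limit of `∫ F (2x'/|x'|²)·∇ψ_ε dx = ∫ F (2/ϱ) ∂_ϱψ_ε dx`. This file computes that limit
(piece P5b of the session frontier):

* `radialConst₂_eq_two_mul_pi` — the planar constant `c₂ = 2|B₁(ℝ²)| = 2π`;
* `fderiv_axisCutoff_apply_eR` — `∂_ϱψ_ε(x) = (2/ε) sT'((2/ε)ϱ(x) - 1)` at every point;
* `integral_axisCutoff_profile` — `∫₀^∞ ρ · (2/ρ) ∂_ρψ_ε dρ = 2`;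
* `integral_axisDrift_axisCutoff_mul` — `∫ (2/ϱ)∂_ϱψ_ε(x) g(x₃) dx = 2c₂ ∫ g` for integrable `g`
  (cylindrical separation of variables, `dx = ϱ dϱ dθ dx₃`);
* `abs_integral_mul_axisDrift_axisCutoff_le` — `|∫ F (2/ϱ)∂_ϱψ_ε| ≤ M · 2c₂ · 2L` for `|F| ≤ M`
  vanishing where `|x₃| > L`;
* `tendsto_integral_mul_axisDrift_axisCutoff` — for `F` continuous with compact support,
  `∫ F (2/ϱ) ∂_ϱψ_ε dx → 2c₂ ∫ F(0, 0, x₃) dx₃ = 4π ∫ F(0,0,x₃) dx₃` as `ε → 0⁺`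
  (`(2/ϱ)∂_ϱψ_ε ≥ 0` has planar mass `2c₂` concentrated on `{ε/2 ≤ ϱ ≤ ε}`, and `F` is uniformly
  continuous: this is "`(2/ε)·2πε ∫ Φη|_{ϱ=ε} dx₃ → 4π ∫ Φη|_{ϱ=0} dx₃`").

## References

* G. Seregin, Anal. Math. Phys. 10 (2020), Paper 46 = arXiv:2006.04140, proof of Lemma 2.2
  (arXiv p. 8), the axis term `4π₀ ∫ πη dx₃dt`. [Seregin2020]
* A. I. Nazarov, N. N. Uraltseva, St. Petersburg Math. J. 23 (2012) 93–115 = arXiv:1011.1888,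
  §4, (4.3) `div b = 4πεδ_Γ` and (4.5). [NazarovUraltseva2012]
-/

-- the problem directory repeats the summit name (D-0017); core's `dupNamespace` linter fires
set_option linter.dupNamespace false

noncomputable section

open MeasureTheory Set Function Filter Topology TopologicalSpace Metric WithLp
open scoped NNReal ENNReal InnerProductSpace RealInnerProductSpace

namespace Summit.NavierStokesRegularity.NavierStokesRegularity.Theorems.AxisymmetricKatoGlobal.EulerScaling

open Literature.Analysis.FluidPDE Literature.Analysis.FluidPDE.Seregin2020 Literature.Analysis.Calculus

/-! ### The constant `c₂ = 2π` -/

/-- `c₂ = 2 |B₁(ℝ²)| = 2π`. [folklore] -/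
theorem radialConst₂_eq_two_mul_pi : radialConst₂ = 2 * Real.pi := by
  rw [radialConst₂, Measure.real, EuclideanSpace.volume_ball_fin_two, ENNReal.ofReal_one, one_pow,
    one_mul, ENNReal.toReal_ofReal Real.pi_pos.le]

/-! ### The radial profile of the axis cut-off -/

/-- **The radial derivative of the axis cut-off `ψ_ε(x) = sT((2/ε)ϱ(x) - 1)`** is the profile
`(2/ε) sT'((2/ε)ϱ(x) - 1)` at EVERY point (off the axis by the chain rule, `Dϱ = ⟪e_ϱ, ·⟫`; on the
axis both sides vanish: `e_ϱ = 0` there and `sT'(-1) = 0`). [folklore] -/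
theorem fderiv_axisCutoff_apply_eR {ε : ℝ} {φ : EuclideanSpace ℝ (Fin 3) → ℝ}
    (hφ : ∀ x, φ x = Real.smoothTransition (2 / ε * cylRadius x - 1)) (x : EuclideanSpace ℝ (Fin 3)) :
    fderiv ℝ φ x (eR x) = deriv Real.smoothTransition (2 / ε * cylRadius x - 1) * (2 / ε) := by
  have hfun : φ = fun x => Real.smoothTransition (2 / ε * cylRadius x - 1) := funext hφ
  by_cases hx : cylRadius x = 0
  · have h1 : eR x = 0 := by simp [eR, hx]
    rw [h1, map_zero, hx, mul_zero, zero_sub, deriv_smoothTransition_of_nonpos (by norm_num), zero_mul]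
  · have ha : HasFDerivAt (fun y : EuclideanSpace ℝ (Fin 3) => 2 / ε * cylRadius y - 1)
        ((2 / ε) • innerSL ℝ (eR x)) x :=
      ((hasFDerivAt_cylRadius hx).const_mul (2 / ε)).sub_const 1
    have hT : HasDerivAt Real.smoothTransition (deriv Real.smoothTransition (2 / ε * cylRadius x - 1))
        (2 / ε * cylRadius x - 1) :=
      ((Real.smoothTransition.contDiff (n := 1)).differentiable one_ne_zero _).hasDerivAt
    have h : HasFDerivAt (fun y : EuclideanSpace ℝ (Fin 3) => Real.smoothTransition (2 / ε * cylRadius y - 1))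
        (deriv Real.smoothTransition (2 / ε * cylRadius x - 1) • (2 / ε) • innerSL ℝ (eR x)) x :=
      hT.comp_hasFDerivAt (f := fun y : EuclideanSpace ℝ (Fin 3) => 2 / ε * cylRadius y - 1) x ha
    rw [hfun, h.fderiv]
    simp only [FunLike.coe_smul, Pi.smul_apply, innerSL_apply_apply, inner_eR_self hx, smul_eq_mul, mul_one]

/-- The profile `ρ ↦ sT((2/ε)ρ - 1)` has derivative `(2/ε) sT'((2/ε)ρ - 1)`. [folklore] -/
theorem hasDerivAt_axisCutoff_profile (ε ρ : ℝ) :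
    HasDerivAt (fun ρ => Real.smoothTransition (2 / ε * ρ - 1))
      (deriv Real.smoothTransition (2 / ε * ρ - 1) * (2 / ε)) ρ := by
  have ha : HasDerivAt (fun ρ : ℝ => 2 / ε * ρ - 1) (2 / ε) ρ := by
    simpa using ((hasDerivAt_id ρ).const_mul (2 / ε)).sub_const 1
  have hT : HasDerivAt Real.smoothTransition (deriv Real.smoothTransition (2 / ε * ρ - 1)) (2 / ε * ρ - 1) :=
    ((Real.smoothTransition.contDiff (n := 1)).differentiable one_ne_zero _).hasDerivAt
  exact hT.comp ρ ha

/-- The profile `(2/ε) sT'((2/ε)ρ - 1)` is nonnegative, continuous, and vanishes for `ρ ≥ ε`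
(and for `ρ ≤ ε/2`). [folklore] -/
theorem axisCutoff_profile_props {ε : ℝ} (hε : 0 < ε) :
    (∀ ρ, 0 ≤ deriv Real.smoothTransition (2 / ε * ρ - 1) * (2 / ε)) ∧
    Continuous (fun ρ => deriv Real.smoothTransition (2 / ε * ρ - 1) * (2 / ε)) ∧
    (∀ ρ, ε ≤ ρ → deriv Real.smoothTransition (2 / ε * ρ - 1) * (2 / ε) = 0) ∧
    (∀ ρ, ρ ≤ ε / 2 → deriv Real.smoothTransition (2 / ε * ρ - 1) * (2 / ε) = 0) := by
  have h2ε : 0 ≤ 2 / ε := div_nonneg zero_le_two hε.le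
  refine ⟨fun ρ => mul_nonneg (LeiZhang2011.deriv_smoothTransition_nonneg _) h2ε, ?_, fun ρ hρ => ?_, fun ρ hρ => ?_⟩
  · exact (((Real.smoothTransition.contDiff (n := 1)).continuous_deriv le_rfl).comp
      ((continuous_const.mul continuous_id).sub continuous_const)).mul continuous_const
  · rw [deriv_smoothTransition_of_one_le, zero_mul]
    rw [le_sub_iff_add_le, div_mul_eq_mul_div, le_div_iff₀ hε]
    linarith
  · rw [deriv_smoothTransition_of_nonpos, zero_mul]
    rw [sub_nonpos, div_mul_eq_mul_div, div_le_one hε]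
    linarith

/-- **The planar mass of the profile**: `ρ · (2/ρ) ∂_ρψ_ε = 2 ∂_ρψ_ε` is integrable on `(0, ∞)`
with `∫₀^∞ ρ (2/ρ) ∂_ρψ_ε dρ = 2 (ψ_ε(∞) - ψ_ε(0)) = 2`. [folklore] -/
theorem integral_axisCutoff_profile {ε : ℝ} (hε : 0 < ε) :
    IntegrableOn (fun ρ : ℝ => ρ * (2 / ρ * (deriv Real.smoothTransition (2 / ε * ρ - 1) * (2 / ε)))) (Ioi 0) ∧
    ∫ ρ in Ioi (0 : ℝ), ρ * (2 / ρ * (deriv Real.smoothTransition (2 / ε * ρ - 1) * (2 / ε))) = 2 := by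
  obtain ⟨-, hcont, hzero, -⟩ := axisCutoff_profile_props hε
  set G' : ℝ → ℝ := fun ρ => deriv Real.smoothTransition (2 / ε * ρ - 1) * (2 / ε) with hG'
  have heq : ∀ ρ ∈ Ioi (0 : ℝ), ρ * (2 / ρ * (deriv Real.smoothTransition (2 / ε * ρ - 1) * (2 / ε))) = 2 * G' ρ := by
    intro ρ hρ
    have hρ0 : (ρ : ℝ) ≠ 0 := ne_of_gt hρ
    simp only [hG']
    field_simp
  -- integrability: continuous on `(0, ε]`, zero on `(ε, ∞)`
  have hI1 : IntegrableOn (fun ρ => 2 * G' ρ) (Ioc 0 ε) :=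
    ((continuous_const.mul hcont).integrableOn_Icc (a := 0) (b := ε)).mono_set Ioc_subset_Icc_self
  have hI2 : IntegrableOn (fun ρ => 2 * G' ρ) (Ioi ε) :=
    (integrableOn_zero).congr_fun (fun ρ hρ => by
      show (0 : ℝ) = 2 * G' ρ
      rw [hG']; beta_reduce; rw [hzero ρ (le_of_lt hρ), mul_zero]) measurableSet_Ioi
  have hI : IntegrableOn (fun ρ => 2 * G' ρ) (Ioi 0) := by
    rw [← Ioc_union_Ioi_eq_Ioi hε.le]
    exact hI1.union hI2
  refine ⟨hI.congr_fun (fun ρ hρ => (heq ρ hρ).symm) measurableSet_Ioi, ?_⟩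
  rw [setIntegral_congr_fun measurableSet_Ioi heq, ← Ioc_union_Ioi_eq_Ioi hε.le,
    setIntegral_union (Set.disjoint_left.2 fun ρ h1 h2 => not_lt.2 h1.2 (mem_Ioi.1 h2)) measurableSet_Ioi hI1 hI2]
  have e2 : ∫ ρ in Ioi ε, 2 * G' ρ = 0 :=
    setIntegral_eq_zero_of_forall_eq_zero fun ρ hρ => by
      rw [hG']; beta_reduce; rw [hzero ρ (le_of_lt hρ), mul_zero]
  have e1 : ∫ ρ in Ioc 0 ε, 2 * G' ρ = 2 := by
    rw [← intervalIntegral.integral_of_le hε.le, intervalIntegral.integral_const_mul,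
      intervalIntegral.integral_eq_sub_of_hasDerivAt (f := fun ρ => Real.smoothTransition (2 / ε * ρ - 1))
        (fun ρ _ => hasDerivAt_axisCutoff_profile ε ρ) (hcont.intervalIntegrable _ _)]
    have h1 : Real.smoothTransition (2 / ε * ε - 1) = 1 := by
      rw [div_mul_cancel₀ _ hε.ne']; norm_num [Real.smoothTransition.one]
    have h0 : Real.smoothTransition (2 / ε * 0 - 1) = 0 :=
      Real.smoothTransition.zero_of_nonpos (by norm_num)
    rw [h1, h0]; norm_num
  rw [e1, e2, add_zero]

/-- **Separation of variables for the axis drift against the cut-off**: for integrable `g`,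
`x ↦ (2/ϱ) ∂_ϱψ_ε(x) g(x₃)` is integrable on `ℝ³` and
`∫ (2/ϱ) ∂_ϱψ_ε(x) g(x₃) dx = 2 c₂ ∫ g` (`dx = ϱ dϱ dθ dx₃`; the tree's
`integrable_and_integral_fun_cylRadius_mul`). [folklore] -/
theorem integral_axisDrift_axisCutoff_mul {ε : ℝ} (hε : 0 < ε) {g : ℝ → ℝ} (hg : Integrable g) :
    Integrable (fun x : EuclideanSpace ℝ (Fin 3) =>
      2 / cylRadius x * (deriv Real.smoothTransition (2 / ε * cylRadius x - 1) * (2 / ε)) * g (x 2)) ∧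
    ∫ x : EuclideanSpace ℝ (Fin 3), 2 / cylRadius x * (deriv Real.smoothTransition (2 / ε * cylRadius x - 1) * (2 / ε)) * g (x 2) =
      2 * radialConst₂ * ∫ z, g z := by
  obtain ⟨hI, hval⟩ := integral_axisCutoff_profile hε
  obtain ⟨hint, h⟩ := integrable_and_integral_fun_cylRadius_mul
    (h := fun ρ => 2 / ρ * (deriv Real.smoothTransition (2 / ε * ρ - 1) * (2 / ε))) hI hg
  refine ⟨hint, ?_⟩
  rw [h, hval]
  ring

/-! ### The axis term -/

/-- `‖x - (0, 0, x₃)‖ = |x'| = ϱ(x)`. [folklore] -/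
theorem dist_meridianPoint_zero (x : EuclideanSpace ℝ (Fin 3)) : dist x (meridianPoint (0, x 2)) = cylRadius x := by
  rw [dist_eq_norm, EuclideanSpace.norm_eq, cylRadius, Fin.sum_univ_three]
  simp [meridianPoint, Real.norm_eq_abs, sq_abs]

/-- `‖(0, 0, z)‖ = |z|`. [folklore] -/
theorem norm_meridianPoint_zero (z : ℝ) : ‖(meridianPoint (0, z) : EuclideanSpace ℝ (Fin 3))‖ = |z| := by
  rw [EuclideanSpace.norm_eq, Fin.sum_univ_three]
  simp [meridianPoint, Real.norm_eq_abs, sq_abs, Real.sqrt_sq_eq_abs]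

/-- **A uniform bound of the axis term**: if `|F| ≤ M`, `F` vanishes where `|x₃| > L` (`L ≥ 0`)
and `F` is a.e.-strongly measurable, then `F · (2/ϱ)∂_ϱψ_ε` is integrable and
`|∫ F (2/ϱ) ∂_ϱψ_ε dx| ≤ M · 2c₂ · 2L` for every `ε > 0`. [folklore] -/
theorem abs_integral_mul_axisDrift_axisCutoff_le {F : EuclideanSpace ℝ (Fin 3) → ℝ}
    (hFm : AEStronglyMeasurable F volume) {M L : ℝ} (hM : ∀ x, |F x| ≤ M) (hL : 0 ≤ L)
    (hFL : ∀ x, L < |x 2| → F x = 0) {ε : ℝ} (hε : 0 < ε) :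
    Integrable (fun x : EuclideanSpace ℝ (Fin 3) =>
      F x * (2 / cylRadius x * (deriv Real.smoothTransition (2 / ε * cylRadius x - 1) * (2 / ε)))) ∧
    |∫ x : EuclideanSpace ℝ (Fin 3), F x * (2 / cylRadius x * (deriv Real.smoothTransition (2 / ε * cylRadius x - 1) * (2 / ε)))| ≤
      M * (2 * radialConst₂ * (2 * L)) := by
  obtain ⟨hnn, -, -, -⟩ := axisCutoff_profile_props hε
  have hM0 : 0 ≤ M := (abs_nonneg _).trans (hM 0)
  -- the dominating function `M · k_ε(x) · 1_{[-L, L]}(x₃)`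
  set g : ℝ → ℝ := (Icc (-L) L).indicator fun _ => M with hg
  have hgi : Integrable g := (integrableOn_const (C := M) (by exact measure_Icc_lt_top.ne)).integrable_indicator measurableSet_Icc
  obtain ⟨hdom, hdomval⟩ := integral_axisDrift_axisCutoff_mul hε hgi
  have hgint : ∫ z, g z = M * (2 * L) := by
    rw [hg, integral_indicator measurableSet_Icc, setIntegral_const, Measure.real, Real.volume_Icc,
      ENNReal.toReal_ofReal (by linarith), smul_eq_mul]
    ring
  have hk0 : ∀ x : EuclideanSpace ℝ (Fin 3), 0 ≤ 2 / cylRadius x * (deriv Real.smoothTransition (2 / ε * cylRadius x - 1) * (2 / ε)) :=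
    fun x => mul_nonneg (div_nonneg zero_le_two (cylRadius_nonneg x)) (hnn _)
  have hbound : ∀ x : EuclideanSpace ℝ (Fin 3),
      ‖F x * (2 / cylRadius x * (deriv Real.smoothTransition (2 / ε * cylRadius x - 1) * (2 / ε)))‖ ≤
        2 / cylRadius x * (deriv Real.smoothTransition (2 / ε * cylRadius x - 1) * (2 / ε)) * g (x 2) := by
    intro x
    rw [Real.norm_eq_abs, abs_mul, abs_of_nonneg (hk0 x)]
    by_cases hx : |x 2| ≤ L
    · have hgx : g (x 2) = M := by rw [hg, Set.indicator_of_mem (mem_Icc.2 (abs_le.1 hx))]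
      rw [hgx, mul_comm]
      exact mul_le_mul_of_nonneg_left (hM x) (hk0 x)
    · rw [hFL x (not_le.1 hx), abs_zero, zero_mul]
      exact mul_nonneg (hk0 x) (by rw [hg]; exact indicator_nonneg (fun _ _ => hM0) _)
  have hmeas : AEStronglyMeasurable (fun x : EuclideanSpace ℝ (Fin 3) =>
      F x * (2 / cylRadius x * (deriv Real.smoothTransition (2 / ε * cylRadius x - 1) * (2 / ε)))) volume := by
    refine hFm.mul (Measurable.aestronglyMeasurable ?_)
    exact (measurable_const.div continuous_cylRadius.measurable).mul
      (((Real.smoothTransition.contDiff (n := 1)).continuous_deriv le_rfl).measurable.comp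
        ((measurable_const.mul continuous_cylRadius.measurable).sub measurable_const) |>.mul measurable_const)
  have hint : Integrable (fun x : EuclideanSpace ℝ (Fin 3) =>
      F x * (2 / cylRadius x * (deriv Real.smoothTransition (2 / ε * cylRadius x - 1) * (2 / ε)))) :=
    hdom.mono' hmeas (Eventually.of_forall hbound)
  refine ⟨hint, ?_⟩
  have h := norm_integral_le_of_norm_le hdom (Eventually.of_forall hbound)
  rw [Real.norm_eq_abs, hdomval, hgint] at h
  calc _ ≤ 2 * radialConst₂ * (M * (2 * L)) := h
    _ = M * (2 * radialConst₂ * (2 * L)) := by ring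

/-- **The axis term of the very weak form.** For `F : ℝ³ → ℝ` continuous with compact support,
`∫ F(x) (2/ϱ) ∂_ϱψ_ε(x) dx → 2c₂ ∫ F(0, 0, x₃) dx₃` as `ε → 0⁺` (`2c₂ = 4π`), where
`ψ_ε(x) = sT((2/ε)ϱ(x) - 1)` is the axis cut-off: the weight `(2/ϱ)∂_ϱψ_ε ≥ 0` lives on
`{ε/2 ≤ ϱ ≤ ε}` and has planar mass `2c₂` on every horizontal slice, while
`|F(x) - F(0,0,x₃)| → 0` uniformly as `ϱ(x) → 0`. This is the boundary term
"`(2/ε)·2πε ∫ Φη|_{ϱ=ε} dx₃ → 4π ∫ Φη|_{ϱ=0} dx₃`" of the derivation of Seregin's displayed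
inequality / Nazarov–Uraltseva's (4.5) from `div(2x'/|x'|²) = 4πδ_{axis}`.
[cite: Seregin2020, proof of Lemma 2.2 (arXiv p. 8), the axis term 4π₀∫πη dx₃dt; NazarovUraltseva2012 (4.3)] -/
theorem tendsto_integral_mul_axisDrift_axisCutoff : ∀ {F : EuclideanSpace ℝ (Fin 3) → ℝ}, Continuous F →
    HasCompactSupport F →
    Tendsto (fun ε : ℝ => ∫ x : EuclideanSpace ℝ (Fin 3),
        F x * (2 / cylRadius x * (deriv Real.smoothTransition (2 / ε * cylRadius x - 1) * (2 / ε))))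
      (𝓝[>] 0) (𝓝 (2 * radialConst₂ * ∫ z : ℝ, F (meridianPoint (0, z)))) := by
  intro F hF hFc
  -- a box containing the support
  obtain ⟨L, hL0, hL⟩ : ∃ L : ℝ, 0 < L ∧ tsupport F ⊆ closedBall (0 : EuclideanSpace ℝ (Fin 3)) L := by
    obtain ⟨R, hR⟩ := hFc.isCompact.isBounded.subset_closedBall 0
    exact ⟨max R 1, lt_of_lt_of_le one_pos (le_max_right _ _), hR.trans (closedBall_subset_closedBall (le_max_left _ _))⟩
  have hF0 : ∀ x : EuclideanSpace ℝ (Fin 3), L < ‖x‖ → F x = 0 := fun x hx =>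
    image_eq_zero_of_notMem_tsupport fun h => by
      have := hL h; rw [mem_closedBall, dist_zero_right] at this; linarith
  have hFL : ∀ x : EuclideanSpace ℝ (Fin 3), L < |x 2| → F x = 0 := fun x hx =>
    hF0 x (lt_of_lt_of_le hx (Literature.Barriers.NavierStokesRegularity.abs_apply_two_le_norm x))
  -- the axis values
  set g : ℝ → ℝ := fun z => F (meridianPoint (0, z)) with hg
  have hmp : Continuous fun z : ℝ => (meridianPoint (0, z) : EuclideanSpace ℝ (Fin 3)) :=
    (contDiff_meridianPoint (n := (⊤ : ℕ∞))).continuous.comp (continuous_const.prodMk continuous_id)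
  have hgc : Continuous g := hF.comp hmp
  have hg0 : ∀ z, L < |z| → g z = 0 := fun z hz => hF0 _ (by rwa [norm_meridianPoint_zero])
  have hgs : HasCompactSupport g := by
    refine HasCompactSupport.intro (isCompact_Icc (a := -L) (b := L)) fun z hz => hg0 z ?_
    rw [mem_Icc, not_and_or, not_le, not_le] at hz
    rcases hz with h | h
    · rw [abs_of_neg (by linarith)]; linarith
    · rw [abs_of_pos (by linarith)]; exact h
  have hgi : Integrable g := hgc.integrable_of_hasCompactSupport hgs
  -- the difference `F(x) - F(0,0,x₃)`: bounded by the modulus of continuity at scale `ϱ(x)`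
  have hUC : UniformContinuous F := hFc.uniformContinuous_of_continuous hF
  rw [Metric.tendsto_nhdsWithin_nhds]
  intro η hη
  set C : ℝ := 2 * radialConst₂ * (2 * L) with hC
  have hCpos : 0 < C := by have := radialConst₂_pos; positivity
  obtain ⟨δ, hδ, hδF⟩ := Metric.uniformContinuous_iff.1 hUC (η / (2 * C)) (by positivity)
  refine ⟨δ, hδ, fun ε hε hεδ => ?_⟩
  have hε0 : 0 < ε := hε
  have hεlt : ε < δ := by rw [dist_zero_right, Real.norm_eq_abs, abs_of_pos hε0] at hεδ; exact hεδ
  obtain ⟨hnn, -, hzero, -⟩ := axisCutoff_profile_props hε0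
  set k : EuclideanSpace ℝ (Fin 3) → ℝ := fun x =>
    2 / cylRadius x * (deriv Real.smoothTransition (2 / ε * cylRadius x - 1) * (2 / ε)) with hk
  have hk0 : ∀ x, 0 ≤ k x := fun x => mul_nonneg (div_nonneg zero_le_two (cylRadius_nonneg x)) (hnn _)
  have hkε : ∀ x, ε < cylRadius x → k x = 0 := fun x hx => by
    rw [hk]; beta_reduce; rw [hzero _ hx.le, mul_zero]
  -- the two integrals
  obtain ⟨M, hM⟩ : ∃ M, ∀ x, |F x| ≤ M := by
    obtain ⟨M, hM⟩ := hF.bounded_above_of_compact_support hFc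
    exact ⟨M, fun x => by simpa [Real.norm_eq_abs] using hM x⟩
  obtain ⟨hFi, -⟩ := abs_integral_mul_axisDrift_axisCutoff_le hF.aestronglyMeasurable hM hL0.le hFL hε0
  obtain ⟨hGi, hGval⟩ := integral_axisDrift_axisCutoff_mul hε0 hgi
  -- the dominating function of the difference
  set d : ℝ → ℝ := (Icc (-L) L).indicator fun _ => η / (2 * C) with hd
  have hdi : Integrable d :=
    (integrableOn_const (C := η / (2 * C)) (by exact measure_Icc_lt_top.ne)).integrable_indicator measurableSet_Icc
  obtain ⟨hDi, hDval⟩ := integral_axisDrift_axisCutoff_mul hε0 hdi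
  have hdint : ∫ z, d z = η / (2 * C) * (2 * L) := by
    rw [hd, integral_indicator measurableSet_Icc, setIntegral_const, Measure.real, Real.volume_Icc,
      ENNReal.toReal_ofReal (by linarith), smul_eq_mul]
    ring
  have hbound : ∀ x : EuclideanSpace ℝ (Fin 3), ‖F x * k x - k x * g (x 2)‖ ≤ k x * d (x 2) := by
    intro x
    rw [show F x * k x - k x * g (x 2) = k x * (F x - g (x 2)) by ring, norm_mul, Real.norm_eq_abs,
      abs_of_nonneg (hk0 x)]
    by_cases hkx : k x = 0
    · rw [hkx, zero_mul, zero_mul]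
    refine mul_le_mul_of_nonneg_left ?_ (hk0 x)
    have hxε : cylRadius x ≤ ε := by
      by_contra h
      exact hkx (hkε x (not_le.1 h))
    by_cases hx2 : |x 2| ≤ L
    · have hdx : d (x 2) = η / (2 * C) := by rw [hd, Set.indicator_of_mem (mem_Icc.2 (abs_le.1 hx2))]
      rw [hdx]
      have hdist : dist x (meridianPoint (0, x 2)) < δ := by
        rw [dist_meridianPoint_zero]; linarith
      exact le_of_lt (hδF hdist)
    · have h1 : F x = 0 := hFL x (not_le.1 hx2)
      have h2 : g (x 2) = 0 := hg0 _ (not_le.1 hx2)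
      rw [h1, h2, sub_zero, norm_zero, hd]
      exact indicator_nonneg (fun _ _ => by positivity) _
  -- conclusion
  have hdiff : (∫ x, F x * k x) - 2 * radialConst₂ * ∫ z, g z = ∫ x, (F x * k x - k x * g (x 2)) := by
    rw [← hGval, ← integral_sub hFi hGi]
  rw [Real.dist_eq, hdiff]
  have hle := norm_integral_le_of_norm_le hDi (Eventually.of_forall hbound)
  rw [Real.norm_eq_abs, hDval, hdint] at hle
  calc |∫ x, (F x * k x - k x * g (x 2))| ≤ 2 * radialConst₂ * (η / (2 * C) * (2 * L)) := hle
    _ = η / 2 := by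
        have hc2 : radialConst₂ ≠ 0 := radialConst₂_pos.ne'
        rw [hC]; field_simp
    _ < η := by linarith

end Summit.NavierStokesRegularity.NavierStokesRegularity.Theorems.AxisymmetricKatoGlobal.EulerScaling

end
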